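import Literature.NumberTheory.EllipticCurves.PadicLogFiniteExtensionEquivProofs
import Literature.NumberTheory.EllipticCurves.TamagawaNeZeroProofs
import Literature.NumberTheory.EllipticCurves.Kramer1981.KernelReductionTwoDivisible
import Mathlib.NumberTheory.LocalField.Basic
import HarnessLib

/-!
# `log_ω = padicLogPointFiniteExt` over a `p`-adic field is a homomorphism on ALL of `E(F)` (proofs only)

Topic `NumberTheory/EllipticCurves`; sequel of `PadicLogFiniteExtension.lean` (the definitions `limitLog`,
`padicLogPointFiniteExt` over a valued field) and `PadicLogFiniteExtensionEquivProofs.lean` (invariance under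
equivalent valuations). THEOREMS ONLY (no definition, no named fact, no instance, no `sorry`).

Brick K4-[ADD] of the hT₂ programme of crux K★ `stmt-BirchSwinnertonDyer-22226` (memo
`Summits/BirchSwinnertonDyer/BirchSwinnertonDyer/Cruxes/StarredOptimalManinUnitFiveSeven/Lines/kato-lever-hT2-programme.md`
§2 [ADD], §4 K2/K4): the hypotheses `hadd₀` / `hadd` of the assembly
`PAdicHodge.exists_smul_range_tower_of_reciprocity` (`DualExpEllipticOfReciprocity.lean`) — additivity of
`log_ω` on the WHOLE Mordell–Weil group of an arbitrary integral model over a `p`-adic field — were so far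
available only on the subgroup of points having a positive multiple in the level `E⁽ᵖ⁾`
(`padicLogPointFiniteExt_add`, with the domain lemma `exists_nsmul_mem_level_of_finite_residueField` for
points of NONSINGULAR reduction). This file removes the restriction:

* `exists_nsmul_mem_level_of_Δ_ne_zero` — **domain lemma, uniform version**: over the fraction field `K` of a
  discrete valuation ring `R` with FINITE residue field, for a Weierstrass equation `W₀` over `R` with `Δ ≠ 0`
  (no minimality) and a valuation `w` with `{w ≤ 1} ⊆ R`, EVERY point of `E(K)` has a positive multiple in
  the level `E⁽ᵖ⁾ = {P ∈ E₁ : |z(P)| ≤ |p|}` (`0 < |p|`). Proof: the saturation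
  `H = {P : ∃ m ≥ 1, m • P ∈ E⁽ᵖ⁾}` is a subgroup containing `E₁(K)`
  (`exists_nsmul_mem_level_of_mem_kernel`), hence of finite index by the tree's pigeonhole
  `WeierstrassCurve.index_ne_zero_of_forall_some_mem` (`TamagawaNeZeroProofs.lean`: Silverman's compactness
  argument *AEC* Ex. 7.6 made algebraic, no Néron model), so `[E(K):H] • P ∈ H` for every `P`.
* `exists_nsmul_mem_level_of_isNonarchimedeanLocalField` — the same for an elliptic Weierstrass equation over
  a non-archimedean local field `F`, integral for a valuation `w` compatible with the valuative structure
  (`R = 𝒪[F]`, Mathlib: a discrete valuation ring with finite residue field).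
* `limitLog_spec_of_isNonarchimedeanLocalField` — (SPEC) for `limitLog w V p` on the level, for every
  compatible `w` (completeness of `F`, `Kramer1981.exists_limit_of_geometric`, transported along the
  equivalence `w ~ ‖·‖` by `limitLog_eq_of_isEquiv` / `level_eq_of_isEquiv`).
* ★ `padicLogPointFiniteExt_add_of_isNonarchimedeanLocalField` — **`log_ω(P + Q) = log_ω(P) + log_ω(Q)` for ALL
  `P, Q ∈ E(F)`**; `padicLogPointFiniteExt_zero_…`, `…_neg_…`, `…_nsmul_…`, and
  `padicLogPointFiniteExt_eq_zero_iff_of_isNonarchimedeanLocalField` (`log_ω P = 0 ↔ P` torsion) likewise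
  unconditionally; ★ `padicLogPointFiniteExt_baseChange_add` — the literal `hadd` shape of the hT₂ assembly
  (`W ×_{K₀} F`, `[Fact p.Prime]`, `valuation F p < 1`).

So, after this file, the recipe of `DualExpEllipticRangeOfTateReciprocity.lean` reads: hT₂
(`PAdicHodge.exists_smul_range_expStarCoord_tower_iff_trace_log`) = [REC] (Kato II Thm. 1.4.1 (4) at the two
levels, one constant) + the Prop-1.2.3 binders; [TD], [N], [ADD] are theorems of the tree. BSD / K★ are not
proved by any of this.

## References
* [SilvermanAEC2009] J. H. Silverman, *The Arithmetic of Elliptic Curves*, 2nd ed. (2009): Prop. IV.3.2,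
  Thm. IV.6.4, Prop. VII.2.1/VII.2.2, VII.6 Cor. 6.2 and Exercise 7.6 (`E(K)/E₁(K)` finite for finite `k`).
* [MazurTateTeitelbaum1986] B. Mazur, J. Tate, J. Teitelbaum, Invent. Math. 84 (1986), §II
  (`log(P) = log([m]P)/m` on all of `E(K)`).
-/

noncomputable section

open scoped Classical NNReal
open ValuativeRel Field
open Literature.NumberTheory.GaloisRepresentations
open Literature.NumberTheory.GaloisRepresentations.IsNonarchimedeanLocalField
open _root_.WeierstrassCurve

namespace Literature.NumberTheory.EllipticCurves.FormalGroupChart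

/-! ### The domain lemma over a discrete valuation ring with finite residue field -/

section DVR

variable {R : Type*} [CommRing R] [IsDomain R] [IsDiscreteValuationRing R]
  [Finite (IsLocalRing.ResidueField R)] {K : Type*} [Field K] [Algebra R K] [IsFractionRing R K]
  {w : Valuation K ℝ≥0}

/-- **Every point of `E(K)` has a positive multiple in the level `E⁽ᵖ⁾`** — uniform version over the fraction
field `K` of a discrete valuation ring `R` with finite residue field, for ANY Weierstrass equation `W₀` over
`R` with `Δ ≠ 0` (no minimality), a valuation `w` on `K` whose closed unit ball lies in `R` and for which the
model is integral, and `0 < |p|`. The saturation `{P : ∃ m ≥ 1, m • P ∈ E⁽ᵖ⁾}` of the level is a subgroup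
containing the kernel of reduction `E₁(K)` (`exists_nsmul_mem_level_of_mem_kernel`), hence of finite index
(`WeierstrassCurve.index_ne_zero_of_forall_some_mem`: `E(K)/E₁(K)` is finite — Silverman's compactness
argument made algebraic), and a subgroup of finite index `n` contains `n • P` for every `P`.
[cite: SilvermanAEC2009, VII.6 Cor. 6.2 and Exercise 7.6; Prop. IV.3.2 with Prop. VII.2.2] -/
theorem exists_nsmul_mem_level_of_Δ_ne_zero (hR : ∀ x : K, w x ≤ 1 → x ∈ Set.range (algebraMap R K))
    (W₀ : WeierstrassCurve R) (hΔ : W₀.Δ ≠ 0) [hV : (W₀.baseChange K).IsIntegral w.integer] {p : ℕ}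
    (hp0 : (p : K) ≠ 0) (P : (W₀.baseChange K).toAffine.Point) :
    ∃ m : ℕ, 0 < m ∧ m • P ∈ level w (W₀.baseChange K) (w (p : K)) := by
  set L : AddSubgroup (W₀.baseChange K).toAffine.Point := level w (W₀.baseChange K) (w (p : K)) with hL
  -- the saturation of the level
  let H : AddSubgroup (W₀.baseChange K).toAffine.Point :=
    { carrier := {P | ∃ m : ℕ, 0 < m ∧ m • P ∈ L}
      zero_mem' := ⟨1, Nat.one_pos, by rw [nsmul_zero]; exact L.zero_mem⟩
      add_mem' := by
        rintro P Q ⟨m, hm, hmP⟩ ⟨n, hn, hnQ⟩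
        refine ⟨m * n, Nat.mul_pos hm hn, ?_⟩
        rw [nsmul_add]
        exact L.add_mem (by rw [mul_nsmul]; exact L.nsmul_mem hmP n)
          (by rw [mul_nsmul']; exact L.nsmul_mem hnQ m)
      neg_mem' := by
        rintro P ⟨m, hm, hmP⟩
        exact ⟨m, hm, by rw [neg_nsmul]; exact L.neg_mem hmP⟩ }
  have hmemH : ∀ Q : (W₀.baseChange K).toAffine.Point, Q ∈ H ↔ ∃ m : ℕ, 0 < m ∧ m • Q ∈ L :=
    fun Q => Iff.rfl
  -- `E₁(K) ⊆ H`
  have hker : ∀ Q ∈ kernel w (W₀.baseChange K), Q ∈ H :=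
    fun Q hQ => (hmemH Q).mpr (exists_nsmul_mem_level_of_mem_kernel hp0 hQ)
  -- hence `H` has finite index
  have hH : ∀ (x y : K) (h : (W₀.baseChange K).toAffine.Nonsingular x y),
      x ∉ Set.range (algebraMap R K) → Affine.Point.some x y h ∈ H := by
    intro x y h hx
    have hx1 : 1 < w x := by
      rw [← not_le]
      exact fun hle => hx (hR x hle)
    exact hker _ (some_mem_kernel h hx1)
  have hidx : H.index ≠ 0 := WeierstrassCurve.index_ne_zero_of_forall_some_mem W₀ hΔ H hH
  -- and `[E(K):H] • P ∈ H`
  obtain ⟨m, hm, hmP⟩ := (hmemH _).mp (AddSubgroup.nsmul_index_mem H P)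
  exact ⟨m * H.index, Nat.mul_pos hm (Nat.pos_of_ne_zero hidx), by rw [mul_nsmul']; exact hmP⟩

end DVR

/-! ### Non-archimedean local fields: the domain lemma, (SPEC), and the homomorphism `log_ω` -/

section LocalField

variable {F : Type*} [Field F] [ValuativeRel F] [TopologicalSpace F] [IsNonarchimedeanLocalField F]

/-- **Over a non-archimedean local field every point of an elliptic curve has a positive multiple in the
level `E⁽ᵖ⁾`** (`0 < |p|`): for an elliptic Weierstrass equation `V` over `F`, integral for a valuation `w`
compatible with the valuative structure, and every `P ∈ E(F)`, some `m • P` (`m ≥ 1`) lies in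
`{Q ∈ E₁(F) : |z(Q)| ≤ |p|}` — so `padicLogPointFiniteExt w V p` takes its genuine (non-junk) value
`ℓ_p(m • P)/m` everywhere on `E(F)`. (`𝒪[F]` is a discrete valuation ring with finite residue field;
apply `exists_nsmul_mem_level_of_Δ_ne_zero` to the `𝒪[F]`-model of `V`.)
[cite: SilvermanAEC2009, VII.6 Cor. 6.2 and Exercise 7.6; Prop. IV.3.2 with Prop. VII.2.2] -/
theorem exists_nsmul_mem_level_of_isNonarchimedeanLocalField (V : WeierstrassCurve F) [V.IsElliptic]
    (w : Valuation F ℝ≥0) [w.Compatible] [hV : V.IsIntegral w.integer] {p : ℕ} (hp0 : (p : F) ≠ 0)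
    (P : V.toAffine.Point) : ∃ m : ℕ, 0 < m ∧ m • P ∈ level w V (w (p : F)) := by
  have hwv : w.IsEquiv (valuation F) := ValuativeRel.isEquiv w (valuation F)
  -- an `𝒪[F]`-model of `V`
  have hint : ∀ {x : F}, w x ≤ 1 → x ∈ 𝒪[F] := fun hx =>
    (Valuation.mem_integer_iff _ _).mpr (hwv.le_one_iff_le_one.mp hx)
  obtain ⟨W₀, hW₀⟩ : ∃ W₀ : WeierstrassCurve 𝒪[F], W₀.baseChange F = V :=
    ⟨⟨⟨V.a₁, hint (val_a₁_le_one (w := w) (V := V))⟩, ⟨V.a₂, hint (val_a₂_le_one (w := w) (V := V))⟩,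
      ⟨V.a₃, hint (val_a₃_le_one (w := w) (V := V))⟩, ⟨V.a₄, hint (val_a₄_le_one (w := w) (V := V))⟩,
      ⟨V.a₆, hint (val_a₆_le_one (w := w) (V := V))⟩⟩, rfl⟩
  subst hW₀
  have hΔ : W₀.Δ ≠ 0 := by
    intro h0
    apply (W₀.baseChange F).Δ'.ne_zero
    rw [coe_Δ', baseChange, map_Δ, h0, map_zero]
  exact exists_nsmul_mem_level_of_Δ_ne_zero (R := 𝒪[F]) (fun x hx => ⟨⟨x, hint hx⟩, rfl⟩) W₀ hΔ hp0 P

/-- **(SPEC) for the limit logarithm over a non-archimedean local field, for every compatible valuation**: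
`|ℓ_p(Q) − z(pʳ·Q)/pʳ| ≤ |p|^{r+1}` for all `Q ∈ E⁽ᵖ⁾` and all `r` (completeness of `F` gives it for the
real absolute value, `Kramer1981.exists_limit_of_geometric` + `limitLog_spec`; `limitLog`, the level and the
inequality are invariant under the equivalence `w ~ ‖·‖`). With this `hℓ` every theorem of the
`FormalGroupChartLimitLog*` / `PadicLogFiniteExtension` files applies to `limitLog w V p`.
[cite: SilvermanAEC2009, Thm. IV.6.4 with Prop. VII.2.2] -/
theorem limitLog_spec_of_isNonarchimedeanLocalField (V : WeierstrassCurve F) (w : Valuation F ℝ≥0)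
    [w.Compatible] [hV : V.IsIntegral w.integer] {p : ℕ} (hp0 : (p : F) ≠ 0)
    (hp : valuation F (p : F) < 1) :
    ∀ Q ∈ level w V (w (p : F)), ∀ r : ℕ,
      w (limitLog w V p Q - ((p ^ r) • Q).zCoord / (p : F) ^ r) ≤ w (p : F) ^ (r + 1) := by
  obtain ⟨w₀, hw₀⟩ := Kramer1981.exists_valuation_eq_algNorm F
  have hwv : w.IsEquiv (valuation F) := ValuativeRel.isEquiv w (valuation F)
  have h01 : ∀ x : F, w₀ x ≤ 1 ↔ x ∈ 𝒪[F] := fun x => by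
    rw [← NNReal.coe_le_coe, hw₀, NNReal.coe_one]; exact algNorm_algebraMap_le_one_iff
  have heq : w.IsEquiv w₀ := by
    rw [Valuation.isEquiv_iff_val_le_one]
    intro x
    rw [h01, hwv.le_one_iff_le_one]
    exact Valuation.mem_integer_iff _ _ |>.symm
  haveI := isIntegral_of_isEquiv heq V
  have hp1 : w₀ (p : F) < 1 := by
    rw [← NNReal.coe_lt_coe, hw₀, NNReal.coe_one]; exact algNorm_algebraMap_lt_one_iff.mpr hp
  have hcomplete := Kramer1981.exists_limit_of_geometric hw₀
  have hcomplete' : ∀ x : ℕ → F, (∀ r, w₀ (x (r + 1) - x r) ≤ w₀ (p : F) ^ (r + 1)) →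
      ∃ y : F, ∀ r, w₀ (y - x r) ≤ w₀ (p : F) ^ (r + 1) := fun x hx => by
    obtain ⟨y, hy⟩ := hcomplete x (w₀ (p : F)) (w₀ (p : F)) hp1 (fun k ↦ by rw [← pow_succ']; exact hx k)
    exact ⟨y, fun r ↦ by rw [pow_succ']; exact hy r⟩
  have hℓ₀ := limitLog_spec (V := V) hp0 hcomplete'
  intro Q hQ r
  rw [level_eq_of_isEquiv heq] at hQ
  have h := hℓ₀ Q hQ r
  rw [← limitLog_eq_of_isEquiv heq p, ← map_pow] at h
  rw [← map_pow, heq.le_iff_le]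
  exact h

omit [TopologicalSpace F] [IsNonarchimedeanLocalField F] in
/-- `|p| < 1` for a compatible `w` from `valuation F p < 1`. [folklore] -/
private theorem val_natCast_lt_one_of_compatible (w : Valuation F ℝ≥0) [w.Compatible] {p : ℕ}
    (hp : valuation F (p : F) < 1) : w (p : F) < 1 :=
  (ValuativeRel.isEquiv w (valuation F)).lt_one_iff_lt_one.mpr hp

/-- ★ **`log_ω` is additive on ALL of `E(F)` over a non-archimedean local field**:
`log_ω(P + Q) = log_ω(P) + log_ω(Q)` for every `P, Q ∈ E(F)`, for an elliptic Weierstrass equation `V`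
over `F` integral for a compatible valuation `w`, `log_ω = padicLogPointFiniteExt w V p` (`0 < |p| < 1`).
(`padicLogPointFiniteExt_add` with both of its side conditions discharged: (SPEC) by completeness, the level
multiples by `exists_nsmul_mem_level_of_isNonarchimedeanLocalField`.)
[cite: SilvermanAEC2009, Thm. IV.6.4(a) with Prop. VII.2.2] [cite: MazurTateTeitelbaum1986, §II] -/
theorem padicLogPointFiniteExt_add_of_isNonarchimedeanLocalField (V : WeierstrassCurve F) [V.IsElliptic]
    (w : Valuation F ℝ≥0) [w.Compatible] [hV : V.IsIntegral w.integer] {p : ℕ} (hp0 : (p : F) ≠ 0)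
    (hp : valuation F (p : F) < 1) (P Q : V.toAffine.Point) :
    padicLogPointFiniteExt w V p (P + Q) = padicLogPointFiniteExt w V p P + padicLogPointFiniteExt w V p Q := by
  obtain ⟨m, hm, hmP⟩ := exists_nsmul_mem_level_of_isNonarchimedeanLocalField V w hp0 P
  obtain ⟨n, hn, hnQ⟩ := exists_nsmul_mem_level_of_isNonarchimedeanLocalField V w hp0 Q
  exact padicLogPointFiniteExt_add hp0 (val_natCast_lt_one_of_compatible w hp)
    (limitLog_spec_of_isNonarchimedeanLocalField V w hp0 hp) hm hmP hn hnQ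

/-- `log_ω(O) = 0` over a non-archimedean local field. [cite: SilvermanAEC2009, Thm. IV.6.4(a)] -/
theorem padicLogPointFiniteExt_zero_of_isNonarchimedeanLocalField (V : WeierstrassCurve F)
    (w : Valuation F ℝ≥0) [w.Compatible] [hV : V.IsIntegral w.integer] {p : ℕ} (hp0 : (p : F) ≠ 0)
    (hp : valuation F (p : F) < 1) :
    padicLogPointFiniteExt w V p (0 : V.toAffine.Point) = 0 :=
  padicLogPointFiniteExt_zero hp0 (val_natCast_lt_one_of_compatible w hp)
    (limitLog_spec_of_isNonarchimedeanLocalField V w hp0 hp)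

/-- `log_ω(−P) = −log_ω(P)` on all of `E(F)` over a non-archimedean local field.
[cite: SilvermanAEC2009, Thm. IV.6.4(a) with Prop. VII.2.2] -/
theorem padicLogPointFiniteExt_neg_of_isNonarchimedeanLocalField (V : WeierstrassCurve F) [V.IsElliptic]
    (w : Valuation F ℝ≥0) [w.Compatible] [hV : V.IsIntegral w.integer] {p : ℕ} (hp0 : (p : F) ≠ 0)
    (hp : valuation F (p : F) < 1) (P : V.toAffine.Point) :
    padicLogPointFiniteExt w V p (-P) = -padicLogPointFiniteExt w V p P := by
  obtain ⟨m, hm, hmP⟩ := exists_nsmul_mem_level_of_isNonarchimedeanLocalField V w hp0 P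
  exact padicLogPointFiniteExt_neg hp0 (val_natCast_lt_one_of_compatible w hp)
    (limitLog_spec_of_isNonarchimedeanLocalField V w hp0 hp) hm hmP

/-- `log_ω(n • P) = n · log_ω(P)` on all of `E(F)` over a non-archimedean local field.
[cite: SilvermanAEC2009, Thm. IV.6.4(a) with Prop. VII.2.2] -/
theorem padicLogPointFiniteExt_nsmul_of_isNonarchimedeanLocalField (V : WeierstrassCurve F) [V.IsElliptic]
    (w : Valuation F ℝ≥0) [w.Compatible] [hV : V.IsIntegral w.integer] {p : ℕ} (hp0 : (p : F) ≠ 0)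
    (hp : valuation F (p : F) < 1) (P : V.toAffine.Point) (n : ℕ) :
    padicLogPointFiniteExt w V p (n • P) = n * padicLogPointFiniteExt w V p P := by
  obtain ⟨m, hm, hmP⟩ := exists_nsmul_mem_level_of_isNonarchimedeanLocalField V w hp0 P
  exact padicLogPointFiniteExt_nsmul hp0 (val_natCast_lt_one_of_compatible w hp)
    (limitLog_spec_of_isNonarchimedeanLocalField V w hp0 hp) hm hmP n

/-- **`log_ω(P) = 0 ↔ P` is torsion**, for EVERY `P ∈ E(F)` over a non-archimedean local field.
[cite: SilvermanAEC2009, Thm. IV.6.4(b) with Prop. VII.2.2] -/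
theorem padicLogPointFiniteExt_eq_zero_iff_of_isNonarchimedeanLocalField (V : WeierstrassCurve F)
    [V.IsElliptic] (w : Valuation F ℝ≥0) [w.Compatible] [hV : V.IsIntegral w.integer] {p : ℕ}
    (hp0 : (p : F) ≠ 0) (hp : valuation F (p : F) < 1) (P : V.toAffine.Point) :
    padicLogPointFiniteExt w V p P = 0 ↔ IsOfFinAddOrder P := by
  obtain ⟨m, hm, hmP⟩ := exists_nsmul_mem_level_of_isNonarchimedeanLocalField V w hp0 P
  exact padicLogPointFiniteExt_eq_zero_iff hp0 (val_natCast_lt_one_of_compatible w hp)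
    (limitLog_spec_of_isNonarchimedeanLocalField V w hp0 hp) hm hmP

/-- **`log_ω` as an additive homomorphism `E(F) →+ F`** exists with the values of `padicLogPointFiniteExt`
(packaging of `padicLogPointFiniteExt_add_of_isNonarchimedeanLocalField`; stated existentially, no definition).
[cite: SilvermanAEC2009, Thm. IV.6.4(a) with Prop. VII.2.2] [cite: MazurTateTeitelbaum1986, §II] -/
theorem exists_addMonoidHom_eq_padicLogPointFiniteExt (V : WeierstrassCurve F) [V.IsElliptic]
    (w : Valuation F ℝ≥0) [w.Compatible] [hV : V.IsIntegral w.integer] {p : ℕ} (hp0 : (p : F) ≠ 0)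
    (hp : valuation F (p : F) < 1) :
    ∃ φ : V.toAffine.Point →+ F, ∀ P, φ P = padicLogPointFiniteExt w V p P :=
  ⟨{ toFun := padicLogPointFiniteExt w V p
     map_zero' := padicLogPointFiniteExt_zero_of_isNonarchimedeanLocalField V w hp0 hp
     map_add' := padicLogPointFiniteExt_add_of_isNonarchimedeanLocalField V w hp0 hp }, fun _ => rfl⟩

/-- ★ **[ADD] in the currency of (S5b) / hT₂** (the hypotheses `hadd₀`, `hadd` of
`PAdicHodge.range_expStarCoord_smul_iff_of_reciprocity` / `PAdicHodge.exists_smul_range_tower_of_reciprocity`,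
verbatim): for an elliptic curve `W/K₀`, a `p`-adic field `F ⊇ K₀` of characteristic `0` with
`valuation F p < 1` and a compatible valuation `w` for which `W ×_{K₀} F` is integral, `log_ω` is additive on
all of `(W ×_{K₀} F)(F)`. [cite: SilvermanAEC2009, Thm. IV.6.4(a) with Prop. VII.2.2] [cite: MazurTateTeitelbaum1986, §II] -/
theorem padicLogPointFiniteExt_baseChange_add [CharZero F] {K₀ : Type*} [Field K₀] (W : WeierstrassCurve K₀)
    [W.IsElliptic] [Algebra K₀ F] {p : ℕ} [Fact p.Prime] (hp : valuation F p < 1)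
    (w : Valuation F ℝ≥0) [w.Compatible] [(W.baseChange F).IsIntegral w.integer]
    (P Q : (W.baseChange F).toAffine.Point) :
    padicLogPointFiniteExt w (W.baseChange F) p (P + Q) =
      padicLogPointFiniteExt w (W.baseChange F) p P + padicLogPointFiniteExt w (W.baseChange F) p Q :=
  padicLogPointFiniteExt_add_of_isNonarchimedeanLocalField (W.baseChange F) w
    (Nat.cast_ne_zero.mpr (Fact.out : p.Prime).ne_zero) hp P Q

end LocalField

end Literature.NumberTheory.EllipticCurves.FormalGroupChart

end
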